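import Summits.FinalStateConjecture.FinalStateConjecture.Theses.BartnikGapSettling
import Summits.FinalStateConjecture.FinalStateConjecture.Theorems.BartnikGapSettlingSettledCaptureStubVisibleRaysStay

/-!
# Birth skeleton v2 for crux `SettledCapture` (stmt-FinalStateConjecture-17328) of route
`BartnikGapSettling` — file `Cruxes/SettledCapture/Lines/birth.lean` (lead prover-line-stmt-FinalStateConjecture-17328-0,
cycle 1 reshape, 2026-08-17)

v1 (planner-skel, sha cd62ef2c) cut the crux as `stub_exteriorCapture` (∃ O d: sub-extremal holes,
`O = exteriorOf 𝒟 d.charted`, `HasExhaustiveCharts d`, `IsFutureOriented d`) → `stub_raysEventuallyVisible`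
(for EVERY such `(O, d)`, every future-complete normalised null ray from `Σ` is cofinally in
`closure d.charted`) → `stub_visibleRaysStay` (causal lemma) → crux.  Wave 1 (2026-08-17):

* `stub_visibleRaysStay` LANDED (p149576,
  `Theorems/BartnikGapSettlingSettledCaptureStubVisibleRaysStay.lean`): below it is discharged by the landed
  theorem, no `sorry`.
* `stub_raysEventuallyVisible` MISSTATED (worker verdict `work/stubs/StubRaysEventuallyVisible-verdict.md`):
  the UNIVERSAL-over-`(O, d)` form with target `closure d.charted` is strictly stronger than the
  composition needs and is paper-false at pocket data (asymptotically flat end # expanding closed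
  hyperbolic pocket: complete pocket rays never approach the honest exterior charts; card
  `Ideas/tendril-swarm-rays.md`, `Theses/PocketUniverses.lean`, stmt-18854); at the Minkowski column the
  crux's own ray clause holds for EVERY legal future-oriented `d` (late flat slabs are entire spacelike
  graphs increasing to `+∞`, so `exteriorOf = J⁺(Σ)`), while the stronger target `closure d.charted` hangs
  on an undecided rigidity question for slowly straightening flat charts.  The crux is existential in
  `(O, d)`, so the faithful cut is EXISTENTIAL: exterior capture WITH cofinally visible rays.
* RESHAPE (this file): ONE GR stub `stub_exteriorCaptureWithVisibleRays` (the crux hypotheses verbatim ⇒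
  `∃ O d`, the four exterior clauses ∧ every future-complete normalised null ray from `Σ` cofinally in
  `closure d.charted`; it absorbs v1's stubs 1 and 2) + the landed causal lemma ⇒ crux, by
  `SettledCapture_of` (sorry-free).  The merged stub CONTAINS the sibling crux `QuietWindowCapture.Capture`
  (stmt-FinalStateConjecture-10115: hypotheses byte-identical, conclusion = its first three clauses), hence
  inherits its record: under THE DODGE of the typed leaf block (`IsNearKerrLeaf` is met by `0`-hole
  boost-stretched TIMELIKE sheets parked anywhere — kernel anchors
  `Literature/Geometry/Lorentzian/NearKerrLeafMinkowski{Dodge,Boosted,BoostedDodge}.lean`,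
  `Theorems/BartnikGapSettlingCaptureStubMinkowskiDodgeLeaves.lean`,
  `Theorems/SettledCapture/Negative/TypedNormalForm.lean` `leafHyp_minkowski`) the hypothesis is idle on
  paper, the stub reads "every complete-𝓘⁺ MGHD of every admissible datum settles to sub-extremal Kerrs
  with visible rays", which is paper-false modulo extremal-Kerr formation in vacuum (Kehle–Unger); no
  repair exists inside the line — the repair is the planners' re-typing of the leaf block over
  `CauchyDevelopment.IsSoundNearKerrLeaf` (as `SoundCapture`, p125313), under which this very cut and the
  landed `stub_visibleRaysStay` (leaf-free) transfer verbatim.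

Disproof used: none exists for this crux (no `Cruxes/SettledCapture/Disproof.lean`, 2026-08-17T09:3xZ).
-/

namespace Summit.FinalStateConjecture.FinalStateConjecture.Cruxes.SettledCapture.Birth

open scoped BigOperators Topology Manifold Classical MeasureTheory ProbabilityTheory Matrix InnerProductSpace ComplexConjugate ContinuousMap
open Filter Set Function TopologicalSpace MeasureTheory
open Literature.Geometry.Lorentzian

/-! ## Statements of the two stubs as named propositions (the skeleton audit reads the hypotheses of
`SettledCapture_of` BY NAME: each head must be a declared stub, whence the `Goal.stub_*` abbreviations). -/

/-- Statement of `stub_exteriorCaptureWithVisibleRays` (EXTERIOR CAPTURE WITH COFINALLY VISIBLE RAYS;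
v2 merge of v1's `ExteriorCapture` and the existential form of `RaysEventuallyVisible`). -/
def ExteriorCaptureWithVisibleRays : Prop := ∀ (X : Type) [TopologicalSpace X] [ChartedSpace E3 X] [IsManifold (𝓡 3) ((⊤ : ℕ∞) : WithTop ℕ∞) X] [T2Space X] [SecondCountableTopology X] [ConnectedSpace X], ∀ D ∈ admissibleVacuumData X, ∀ 𝒟 : VacuumCauchyDevelopment D, 𝒟.IsMaximal → Summit.FinalStateConjecture.HasCompleteNullInfinity 𝒟.toCauchyDevelopment → (∃ (N₀ : ℕ) (m₀ χ : ℝ) (k₁ : ℕ) (ε₁ : ENNReal), 0 < m₀ ∧ χ < 1 ∧ 0 < ε₁ ∧ ∀ (k : ℕ) (ε : ENNReal), 0 < ε → ∀ K : Set 𝒟.carrier, IsCompact K → ∃ (N : ℕ) (M a : Fin N → ℝ) (S : Set 𝒟.carrier), N ≤ N₀ ∧ (∀ i, m₀ ≤ M i ∧ M i ≤ m₀⁻¹) ∧ Disjoint S (𝒟.metric.causalPast 𝒟.timeOrientation K) ∧ (∃ (R ρ : Fin N → ℝ) (mo : Fin N → lorentzGroup × E4) (r : Fin N → E4 → ℝ)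 (B : Fin N → ModelBackground) (U₀ : TopologicalSpace.Opens E4) (B₀ : ModelBackground) (Ψ : ∀ i, (B i).domain → 𝒟.carrier) (Ψ₀ : B₀.domain → 𝒟.carrier) (L W : ∀ i, Set (B i).domain) (L₀ W₀ : Set B₀.domain), (∀ i, r i = fun x => Kerr.radius (a i) (poincareInv (mo i).1 (mo i).2 x)) ∧ (∀ i, B i = (⟨⟨poincareInv (mo i).1 (mo i).2 ⁻¹' (Kerr.region (a i) (M i) : Set E4), (Kerr.region (a i) (M i)).isOpen.preimage (continuous_poincareInv (mo i).1 (mo i).2)⟩, boostedKerrBilin (mo i).1 (mo i).2 (M i) (a i), fun x => poincareInv (mo i).1 (mo i).2 x 0, r i⟩ : ModelBackground)) ∧ B₀ = (⟨U₀, fun _ => Minkowski.bilin, fun x => x 0 - Real.sqrt (1 + E4.spatialNorm x ^ 2), E4.spatialNorm⟩ : ModelBackground) ∧ (∀ i, L i = {x | -1 < (B i).time x.1 ∧ (B i).time x.1 < 1 ∧ (B i).radius x.1 < R i + 1} ∧ W i = {x | 0 < (B i).time x.1 ∧ (B i).time x.1 < 1 ∧ (B i).radius x.1 ≤ R i}) ∧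 L₀ = {x | -1 < B₀.time x.1 ∧ B₀.time x.1 < 1} ∧ W₀ = {x | 0 < B₀.time x.1 ∧ B₀.time x.1 < 1} ∧ (∀ i, 0 < M i ∧ |a i| ≤ M i ∧ 0 < ρ i ∧ ρ i < R i) ∧ {x : E4 | -1 < x 0 - Real.sqrt (1 + E4.spatialNorm x ^ 2) ∧ ∀ i, ρ i < r i x} ⊆ (U₀ : Set E4) ∧ (∀ i, ContMDiffOn 𝓘(ℝ, E4) (𝓡 4) ((⊤ : ℕ∞) : WithTop ℕ∞) (Ψ i) (L i) ∧ Topology.IsOpenEmbedding ((L i).restrict (Ψ i)) ∧ Ψ i '' L i ⊆ 𝒟.metric.causalFuture 𝒟.timeOrientation (Set.range 𝒟.embed)) ∧ ContMDiffOn 𝓘(ℝ, E4) (𝓡 4) ((⊤ : ℕ∞) : WithTop ℕ∞) Ψ₀ L₀ ∧ Topology.IsOpenEmbedding (L₀.restrict Ψ₀) ∧ Ψ₀ '' L₀ ⊆ 𝒟.metric.causalFuture 𝒟.timeOrientation (Set.range 𝒟.embed) ∧ (∀ i, 𝒟.toSpacetime.truncDeviationCk (B i) (Ψ i) k (R i)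 0 ≤ ε) ∧ 𝒟.toSpacetime.deviationCk B₀ Ψ₀ k 0 ≤ ε ∧ Pairwise (Function.onFun Disjoint fun i => Ψ i '' {x | x ∈ L i ∧ (B i).radius x.1 ≤ R i}) ∧ (∀ i, Ψ i '' {x | (B i).time x.1 = 0 ∧ ρ i < (B i).radius x.1 ∧ (B i).radius x.1 ≤ R i} ⊆ Ψ₀ '' L₀) ∧ (∀ i, Ψ₀ '' {x | B₀.time x.1 = 0 ∧ ρ i < r i x.1 ∧ r i x.1 < R i} ⊆ Ψ i '' L i) ∧ S = Ψ₀ '' B₀.timeSlab 0 ∪ ⋃ i, Ψ i '' (B i).truncTimeSlab (R i) 0 ∧ Ψ₀ '' W₀ ∪ ⋃ i, Ψ i '' W i ⊆ 𝒟.metric.chronologicalFuture 𝒟.timeOrientation S ∧ Summit.FinalStateConjecture.exteriorOf 𝒟.toCauchyDevelopment (Ψ₀ '' W₀ ∪ ⋃ i, Ψ i '' W i) \ (Ψ₀ '' W₀ ∪ ⋃ i, Ψ i '' W i) ⊆ 𝒟.metric.causalPast 𝒟.timeOrientation S) ∧ (k₁ ≤ k → ε ≤ ε₁ → ∀ i,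 |a i| ≤ χ * M i)) → ∃ (O : Set 𝒟.carrier) (d : FinalStateDecomposition 𝒟.toSpacetime O 2), (∀ i, Kerr.IsSubextremal (d.mass i) (d.spin i)) ∧ O = Summit.FinalStateConjecture.exteriorOf 𝒟.toCauchyDevelopment d.charted ∧ Summit.FinalStateConjecture.HasExhaustiveCharts d ∧ Summit.FinalStateConjecture.IsFutureOriented d ∧ (∀ [𝒟.metric.HasLeviCivita], ∀ (p : X) (γ : ℝ → 𝒟.carrier) (dom : Set ℝ), 𝒟.metric.IsNormalisedNullRayFrom 𝒟.timeOrientation 𝒟.embed 𝒟.normal p γ dom → ¬ BddAbove dom → ∀ t ∈ dom, ∃ t' ∈ dom, t ≤ t' ∧ γ t' ∈ closure d.charted)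

/-- Statement of `stub_visibleRaysStay` (VISIBLE POINTS OF RAYS LIE IN `closure O`; landed p149576). -/
def VisibleRaysStay : Prop := ∀ (X : Type) [TopologicalSpace X] [ChartedSpace E3 X] [IsManifold (𝓡 3) ((⊤ : ℕ∞) : WithTop ℕ∞) X] [T2Space X] [SecondCountableTopology X] [ConnectedSpace X], ∀ D ∈ admissibleVacuumData X, ∀ 𝒟 : VacuumCauchyDevelopment D, ∀ (O : Set 𝒟.carrier) (d : FinalStateDecomposition 𝒟.toSpacetime O 2), O = Summit.FinalStateConjecture.exteriorOf 𝒟.toCauchyDevelopment d.charted → ∀ [𝒟.metric.HasLeviCivita], ∀ (p : X) (γ : ℝ → 𝒟.carrier) (dom : Set ℝ), 𝒟.metric.IsNormalisedNullRayFrom 𝒟.timeOrientation 𝒟.embed 𝒟.normal p γ dom → ∀ t ∈ dom, ∀ t' ∈ dom, 0 ≤ t → t ≤ t' → γ t' ∈ closure d.charted → γ t ∈ closure O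

namespace Goal
/-- Statement of `stub_exteriorCaptureWithVisibleRays`, under the stub's name. -/
abbrev stub_exteriorCaptureWithVisibleRays : Prop := ExteriorCaptureWithVisibleRays
/-- Statement of `stub_visibleRaysStay`, under the stub's name. -/
abbrev stub_visibleRaysStay : Prop := VisibleRaysStay
end Goal

/-! ## Registered stubs, stated expanded (the only `sorry` of the file is the GR stub). -/

/-- stub A — EXTERIOR CAPTURE WITH COFINALLY VISIBLE RAYS (open; the crux's GR content): the crux's
hypotheses verbatim ⇒ a C² final-state decomposition `d` of `O = exteriorOf 𝒟 d.charted` with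
sub-extremal holes, exhaustive honest-radius charts, future-oriented chart times, such that every
future-complete normalised null ray from `Σ` returns to `closure d.charted` beyond every parameter.
Sub-extremal Kerr stability with interior hyperboloidal data (`N ≤ 1`), multi-Kerr capture (`N ≥ 2`),
plus interior null incompleteness / needle-chartability of invisible complete rays. -/
theorem stub_exteriorCaptureWithVisibleRays : ∀ (X : Type) [TopologicalSpace X] [ChartedSpace E3 X] [IsManifold (𝓡 3) ((⊤ : ℕ∞) : WithTop ℕ∞) X] [T2Space X] [SecondCountableTopology X] [ConnectedSpace X], ∀ D ∈ admissibleVacuumData X, ∀ 𝒟 : VacuumCauchyDevelopment D, 𝒟.IsMaximal → Summit.FinalStateConjecture.HasCompleteNullInfinity 𝒟.toCauchyDevelopment → (∃ (N₀ : ℕ) (m₀ χ : ℝ) (k₁ : ℕ) (ε₁ : ENNReal), 0 < m₀ ∧ χ < 1 ∧ 0 < ε₁ ∧ ∀ (k : ℕ) (ε : ENNReal), 0 < ε → ∀ K : Set 𝒟.carrier, IsCompact K → ∃ (N : ℕ) (M a : Fin N → ℝ) (S : Set 𝒟.carrier), N ≤ N₀ ∧ (∀ i, m₀ ≤ M i ∧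 M i ≤ m₀⁻¹) ∧ Disjoint S (𝒟.metric.causalPast 𝒟.timeOrientation K) ∧ (∃ (R ρ : Fin N → ℝ) (mo : Fin N → lorentzGroup × E4) (r : Fin N → E4 → ℝ) (B : Fin N → ModelBackground) (U₀ : TopologicalSpace.Opens E4) (B₀ : ModelBackground) (Ψ : ∀ i, (B i).domain → 𝒟.carrier) (Ψ₀ : B₀.domain → 𝒟.carrier) (L W : ∀ i, Set (B i).domain) (L₀ W₀ : Set B₀.domain), (∀ i, r i = fun x => Kerr.radius (a i) (poincareInv (mo i).1 (mo i).2 x)) ∧ (∀ i, B i = (⟨⟨poincareInv (mo i).1 (mo i).2 ⁻¹' (Kerr.region (a i) (M i) : Set E4), (Kerr.region (a i) (M i)).isOpen.preimage (continuous_poincareInv (mo i).1 (mo i).2)⟩, boostedKerrBilin (mo i).1 (mo i).2 (M i) (a i), fun x => poincareInv (mo i).1 (mo i).2 x 0, r i⟩ : ModelBackground)) ∧ B₀ = (⟨U₀, fun _ => Minkowski.bilin, fun x => x 0 - Real.sqrt (1 + E4.spatialNorm x ^ 2), E4.spatialNorm⟩ : ModelBackground) ∧ (∀ i, L i = {x |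 -1 < (B i).time x.1 ∧ (B i).time x.1 < 1 ∧ (B i).radius x.1 < R i + 1} ∧ W i = {x | 0 < (B i).time x.1 ∧ (B i).time x.1 < 1 ∧ (B i).radius x.1 ≤ R i}) ∧ L₀ = {x | -1 < B₀.time x.1 ∧ B₀.time x.1 < 1} ∧ W₀ = {x | 0 < B₀.time x.1 ∧ B₀.time x.1 < 1} ∧ (∀ i, 0 < M i ∧ |a i| ≤ M i ∧ 0 < ρ i ∧ ρ i < R i) ∧ {x : E4 | -1 < x 0 - Real.sqrt (1 + E4.spatialNorm x ^ 2) ∧ ∀ i, ρ i < r i x} ⊆ (U₀ : Set E4) ∧ (∀ i, ContMDiffOn 𝓘(ℝ, E4) (𝓡 4) ((⊤ : ℕ∞) : WithTop ℕ∞) (Ψ i) (L i) ∧ Topology.IsOpenEmbedding ((L i).restrict (Ψ i)) ∧ Ψ i '' L i ⊆ 𝒟.metric.causalFuture 𝒟.timeOrientation (Set.range 𝒟.embed)) ∧ ContMDiffOn 𝓘(ℝ, E4) (𝓡 4) ((⊤ : ℕ∞) : WithTop ℕ∞) Ψ₀ L₀ ∧ Topology.IsOpenEmbedding (L₀.restrict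 Ψ₀) ∧ Ψ₀ '' L₀ ⊆ 𝒟.metric.causalFuture 𝒟.timeOrientation (Set.range 𝒟.embed) ∧ (∀ i, 𝒟.toSpacetime.truncDeviationCk (B i) (Ψ i) k (R i) 0 ≤ ε) ∧ 𝒟.toSpacetime.deviationCk B₀ Ψ₀ k 0 ≤ ε ∧ Pairwise (Function.onFun Disjoint fun i => Ψ i '' {x | x ∈ L i ∧ (B i).radius x.1 ≤ R i}) ∧ (∀ i, Ψ i '' {x | (B i).time x.1 = 0 ∧ ρ i < (B i).radius x.1 ∧ (B i).radius x.1 ≤ R i} ⊆ Ψ₀ '' L₀) ∧ (∀ i, Ψ₀ '' {x | B₀.time x.1 = 0 ∧ ρ i < r i x.1 ∧ r i x.1 < R i} ⊆ Ψ i '' L i) ∧ S = Ψ₀ '' B₀.timeSlab 0 ∪ ⋃ i, Ψ i '' (B i).truncTimeSlab (R i) 0 ∧ Ψ₀ '' W₀ ∪ ⋃ i, Ψ i '' W i ⊆ 𝒟.metric.chronologicalFuture 𝒟.timeOrientation S ∧ Summit.FinalStateConjecture.exteriorOf 𝒟.toCauchyDevelopment (Ψ₀ '' W₀ ∪ ⋃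 i, Ψ i '' W i) \ (Ψ₀ '' W₀ ∪ ⋃ i, Ψ i '' W i) ⊆ 𝒟.metric.causalPast 𝒟.timeOrientation S) ∧ (k₁ ≤ k → ε ≤ ε₁ → ∀ i, |a i| ≤ χ * M i)) → ∃ (O : Set 𝒟.carrier) (d : FinalStateDecomposition 𝒟.toSpacetime O 2), (∀ i, Kerr.IsSubextremal (d.mass i) (d.spin i)) ∧ O = Summit.FinalStateConjecture.exteriorOf 𝒟.toCauchyDevelopment d.charted ∧ Summit.FinalStateConjecture.HasExhaustiveCharts d ∧ Summit.FinalStateConjecture.IsFutureOriented d ∧ (∀ [𝒟.metric.HasLeviCivita], ∀ (p : X) (γ : ℝ → 𝒟.carrier) (dom : Set ℝ), 𝒟.metric.IsNormalisedNullRayFrom 𝒟.timeOrientation 𝒟.embed 𝒟.normal p γ dom → ¬ BddAbove dom → ∀ t ∈ dom, ∃ t' ∈ dom, t ≤ t' ∧ γ t' ∈ closure d.charted) := by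
  sorry

/-- stub B — VISIBLE POINTS OF RAYS LIE IN `closure O` (LANDED, p149576: discharged by the tree theorem
`Theorems.BartnikGapSettling.SettledCapture.stub_visibleRaysStay`; causal theory only). -/
theorem stub_visibleRaysStay : ∀ (X : Type) [TopologicalSpace X] [ChartedSpace E3 X] [IsManifold (𝓡 3) ((⊤ : ℕ∞) : WithTop ℕ∞) X] [T2Space X] [SecondCountableTopology X] [ConnectedSpace X], ∀ D ∈ admissibleVacuumData X, ∀ 𝒟 : VacuumCauchyDevelopment D, ∀ (O : Set 𝒟.carrier) (d : FinalStateDecomposition 𝒟.toSpacetime O 2), O = Summit.FinalStateConjecture.exteriorOf 𝒟.toCauchyDevelopment d.charted → ∀ [𝒟.metric.HasLeviCivita], ∀ (p : X) (γ : ℝ → 𝒟.carrier) (dom : Set ℝ), 𝒟.metric.IsNormalisedNullRayFrom 𝒟.timeOrientation 𝒟.embed 𝒟.normal p γ dom → ∀ t ∈ dom, ∀ t' ∈ dom, 0 ≤ t → t ≤ t' → γ t' ∈ closure d.charted → γ t ∈ closure O :=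
  Summit.FinalStateConjecture.FinalStateConjecture.Theorems.BartnikGapSettling.SettledCapture.stub_visibleRaysStay

/-! Consistency (elaborated, not kept in the environment). -/
example : Goal.stub_exteriorCaptureWithVisibleRays := stub_exteriorCaptureWithVisibleRays
example : Goal.stub_visibleRaysStay := stub_visibleRaysStay

/-! ## The composition (kernel-checked; no `sorry` of its own) -/

/-- THE CRUX BY NAME from the one open stub (stub B being the landed theorem, discharged inside):
stub A gives `(O, d)` with cofinally visible rays; for a complete ray and `t ≥ 0`, a later visible
parameter `t'` and stub B put `γ t` in `closure O` — that is `RaysStayInClosure 𝒟 O`. -/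
theorem SettledCapture_of :
    Goal.stub_exteriorCaptureWithVisibleRays →
      Summit.FinalStateConjecture.FinalStateConjecture.Theses.BartnikGapSettling.SettledCapture := by
  intro hA X _ _ _ _ _ _ D hD 𝒟 hmax hscri hleaves
  have hB : Goal.stub_visibleRaysStay := stub_visibleRaysStay
  obtain ⟨O, d, hsub, hO, hexh, hfut, hvis⟩ := hA X D hD 𝒟 hmax hscri hleaves
  refine ⟨O, d, hsub, hO, ?_, hexh, hfut⟩
  intro inst p γ dom hγ hdom t ht h0
  obtain ⟨t', ht', htt', hv⟩ := hvis p γ dom hγ hdom t ht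
  exact hB X D hD 𝒟 O d hO p γ dom hγ t ht t' ht' h0 htt' hv

end Summit.FinalStateConjecture.FinalStateConjecture.Cruxes.SettledCapture.Birth
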